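import Mathlib
import Literature.AlgebraicGeometry.Resolution.CobordantGame
import Summits.ResolutionOfSingularities.ResolutionOfSingularities.Theses.WeightedInvariant

/-!
# `WeightedInvariant.LocalWeightedDrop`: the `L`-GRADED GAME and the reduction of the crux to it

Route `ResolutionOfSingularities/WeightedInvariant`, crux `LocalWeightedDrop`
(stmt-ResolutionOfSingularities-8899).  [OURS · L1 W4.3] — the §5 «graded game» module of ideator
res-L1-w43-idea-1's `Sketch-L1-idea-1.lean` v3 (sha16 `631198685223c190`, round 3), landed verbatim
(definitions and the two sorry-free theorems, plus the self-contained `gammaTwoKey` key of §6) on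
res-L1-w43-plan-1's ORDER (o6), CHAIN w43 v4.4.2.  Nothing here is a statement of the manuscript under
review on ladder RESOLUTION; no new mathematics beyond the sketch.

Setting of `LocalWeightedDrop`: positions are formal germs `f ∈ k[[y₁..yₘ]]`, a move is a formal
coordinate change `θ` with weights `w` (`CobordantGame.IsMove`), and the successor at the exceptional point
`c` of the cobordant chart `CobordantGame.cruxChart w c` is `g ∈ k[[s, y₁..yₘ]]` with `f(θ)(chart_c) = sᵃ·g`.

**The graded game.**  A grading of `k[[y₁..yₘ]]` by a diagonalizable group `D ⊆ 𝔾ₘᵐ` is recorded by the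
lattice `L ⊆ ℤᵐ` of characters of `𝔾ₘᵐ` trivial on `D` (`L = ⊤` is no grading; `ℤᵐ/L` with `p`-torsion is
a non-reduced `D` — the wild case).  `f` is `L`-homogeneous (`IsLHomogeneous`) iff its exponents are
pairwise congruent mod `L`; a move is `L`-graded (`IsLGradedMove`) iff its coordinate change is
`D`-equivariant; at the exceptional point `c` of a graded move the successor is graded by the lattice
`succLattice L w c` of the stabiliser of `c` in `D × 𝔾ₘ(new)`.  `GradedWonBy α m L f`: the Prover, playing
`L`-graded moves only, wins `f` with rank `< α`, every singular successor (`IsSuccessorAt`, = the crux's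
`IsSuccessor` with `c` and `a` exposed) being won in the propagated grading with smaller rank.

**Results (sorry-free).**
* `GradedGame.wonBy_of_gradedWonBy` — graded wins are wins of the plain game `CobordantGame.WonBy`
  (same successors, fewer moves); transfinite induction on the rank.
* `GradedGame.localWeightedDrop_of_graded` — if every `L`-homogeneous singular germ is won in the
  `L`-graded game (all `p`, `k`, `m`, `L`), then `Theses.WeightedInvariant.LocalWeightedDrop` BY NAME, via
  `CobordantGame.hasRank_iff_allWon` / `hasRank_iff_literal` at `L = ⊤`.  This is a REDUCTION of the crux to
  a class-level graded statement (taken as the hypothesis `h`; the audit records it as conditional) — it does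
  not close the crux.
* `GradedGame.gammaTwoKey_fatPoint_lt` — the §6 value key `Γ″ = lex(a₁, a₂, c, a₃, …)` ASCENDS on fat points
  `(2,…,2)` of growing length, so the fat-pair escape of the route's negative files does not bite it.
-/

set_option linter.dupNamespace false -- mandated namespace of this single-conjunct summit
set_option autoImplicit false

namespace Summit.ResolutionOfSingularities.ResolutionOfSingularities.Theorems

namespace GradedGame

open MvPowerSeries
open Literature.AlgebraicGeometry.Resolution

variable {k : Type} [Field k]

/-- An exponent as an integer vector. [OURS · L1 W4.3, Sketch-L1-idea-1 v3 §5] -/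
def expVec {m : ℕ} (e : Fin m →₀ ℕ) : Fin m → ℤ := fun i => (e i : ℤ)

/-- `φ` is homogeneous for the grading lattice `L`: its exponents are pairwise congruent modulo `L`.
[OURS · L1 W4.3, Sketch-L1-idea-1 v3 §5] -/
def IsLHomogeneous {m : ℕ} (L : AddSubgroup (Fin m → ℤ)) (φ : MvPowerSeries (Fin m) k) : Prop :=
  ∀ e e' : Fin m →₀ ℕ, coeff e φ ≠ 0 → coeff e' φ ≠ 0 → expVec e - expVec e' ∈ L

/-- An `L`-GRADED MOVE: a legal move whose coordinate change is `D(ℤᵐ/L)`-equivariant (`θᵢ` has the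
character of `yᵢ`). [OURS · L1 W4.3, Sketch-L1-idea-1 v3 §5] -/
def IsLGradedMove {m : ℕ} (L : AddSubgroup (Fin m → ℤ)) (θ : Fin m → MvPowerSeries (Fin m) k)
    (w : Fin m → ℕ) : Prop :=
  CobordantGame.IsMove k θ w ∧ ∀ i, ∀ e : Fin m →₀ ℕ, coeff e (θ i) ≠ 0 → expVec e - Pi.single i 1 ∈ L

/-- `CobordantGame.IsSuccessor` with the exceptional point `c` and the exponent `a` exposed: `c` is off the
vertex, `f(θ)(chart_c) = sᵃ·g`, `s ∤ g`, and `g ∈ 𝔪²`. [OURS · L1 W4.3, Sketch-L1-idea-1 v3 §5] -/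
def IsSuccessorAt {m : ℕ} (f : MvPowerSeries (Fin m) k) (θ : Fin m → MvPowerSeries (Fin m) k)
    (w : Fin m → ℕ) (c : Fin m → k) (a : ℕ) (g : MvPowerSeries (Fin (m + 1)) k) : Prop :=
  (∃ i, 0 < w i ∧ c i ≠ 0) ∧
    subst (CobordantGame.cruxChart k w c) (subst θ f) = X (0 : Fin (m + 1)) ^ a * g ∧
    ¬ (X (0 : Fin (m + 1)) ∣ g) ∧ (constantCoeff g = 0 ∧ ∀ j, coeff (Finsupp.single j 1) g = 0)

/-- The grading lattice of the successor at the exceptional point `c` of a move with weights `w`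
(variables `s = 0`, `yⱼ = j+1`): generated by `(w·r ; r)` for `r ∈ L` (the old group, acting on `s`
through the weights) and by the unit vectors of the translated coordinates `yⱼ`, `cⱼ ≠ 0 < wⱼ` (the
stabiliser condition).  For `L = ⊤` the quotient `ℤ^{m+1}/succLattice` is `ℤ/G(c)`,
`G(c) = gcd {wⱼ : cⱼ ≠ 0 < wⱼ}`. [OURS · L1 W4.3, Sketch-L1-idea-1 v3 §5] -/
def succLattice {m : ℕ} (L : AddSubgroup (Fin m → ℤ)) (w : Fin m → ℕ) (c : Fin m → k) :
    AddSubgroup (Fin (m + 1) → ℤ) :=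
  AddSubgroup.closure
    ({v | ∃ r ∈ L, v = Matrix.vecCons (∑ j, (w j : ℤ) * r j) r} ∪
      {v | ∃ j : Fin m, c j ≠ 0 ∧ 0 < w j ∧ v = Pi.single j.succ 1})

/-- WON IN THE GRADED GAME with rank `< α`: the Prover plays `L`-graded moves only; every singular
successor, with its propagated grading `succLattice L w c`, is won with smaller rank.  (Same successors as
the plain game, fewer moves: `wonBy_of_gradedWonBy`.)  Defined by well-founded recursion on the ordinal.
[OURS · L1 W4.3, Sketch-L1-idea-1 v3 §5] -/
def GradedWonBy : Ordinal.{0} → (m : ℕ) → AddSubgroup (Fin m → ℤ) → MvPowerSeries (Fin m) k → Prop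
  | α, m, L, f => ∃ (θ : Fin m → MvPowerSeries (Fin m) k) (w : Fin m → ℕ), IsLGradedMove L θ w ∧
      ∀ (c : Fin m → k) (a : ℕ) (g : MvPowerSeries (Fin (m + 1)) k), IsSuccessorAt f θ w c a g →
        ∃ (β : Ordinal.{0}) (_ : β < α), GradedWonBy β (m + 1) (succLattice L w c) g
  termination_by α => α

/-- Unfolding of `GradedWonBy`. [OURS · L1 W4.3, Sketch-L1-idea-1 v3 §5] -/
theorem gradedWonBy_iff (α : Ordinal.{0}) {m : ℕ} (L : AddSubgroup (Fin m → ℤ))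
    (f : MvPowerSeries (Fin m) k) :
    GradedWonBy α m L f ↔ ∃ (θ : Fin m → MvPowerSeries (Fin m) k) (w : Fin m → ℕ), IsLGradedMove L θ w ∧
      ∀ (c : Fin m → k) (a : ℕ) (g : MvPowerSeries (Fin (m + 1)) k), IsSuccessorAt f θ w c a g →
        ∃ β, β < α ∧ GradedWonBy β (m + 1) (succLattice L w c) g := by
  rw [GradedWonBy]
  simp only [exists_prop]

/-- The easy direction: graded wins are wins of the plain game (same successors, fewer moves);
transfinite induction on the rank. [OURS · L1 W4.3, Sketch-L1-idea-1 v3 §5] -/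
theorem wonBy_of_gradedWonBy (α : Ordinal.{0}) :
    ∀ {m : ℕ} (L : AddSubgroup (Fin m → ℤ)) (f : MvPowerSeries (Fin m) k),
      GradedWonBy α m L f → CobordantGame.WonBy k α m f := by
  induction α using WellFoundedLT.induction with
  | ind α ih =>
    intro m L f h
    rw [gradedWonBy_iff] at h
    obtain ⟨θ, w, hθ, hs⟩ := h
    rw [CobordantGame.wonBy_iff]
    refine ⟨θ, w, hθ.1, fun g hg => ?_⟩
    obtain ⟨c, a, hrest⟩ := hg
    obtain ⟨β, hβ, hW⟩ := hs c a g hrest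
    exact ⟨β, hβ, ih β hβ (succLattice L w c) g hW⟩

/-- CARD A REDUCED TO THE GRADED GAME: if every `L`-homogeneous singular germ is won in the `L`-graded game
(all `p, k, m, L`), then `LocalWeightedDrop` (the route decl, by name).  From `wonBy_of_gradedWonBy` at
`L = ⊤` and `CobordantGame.hasRank_iff_allWon` / `hasRank_iff_literal`.  The hypothesis `h` is the
class-level graded statement the line bets on; this theorem is the proved seam, not a proof of the crux.
[OURS · L1 W4.3, Sketch-L1-idea-1 v3 §5] -/
theorem localWeightedDrop_of_graded
    (h : ∀ p : ℕ, p.Prime → ∀ (k : Type) [Field k] [CharP k p] [IsAlgClosed k],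
      ∀ (m : ℕ) (L : AddSubgroup (Fin m → ℤ)) (f : MvPowerSeries (Fin m) k),
        IsLHomogeneous L f → CobordantGame.IsSingular k f → ∃ α, GradedWonBy α m L f) :
    Summit.ResolutionOfSingularities.ResolutionOfSingularities.Theses.WeightedInvariant.LocalWeightedDrop := by
  intro p hp k _ _ _
  apply (CobordantGame.hasRank_iff_literal (k := k)).mp
  apply (CobordantGame.hasRank_iff_allWon (k := k)).mpr
  intro n f hf
  obtain ⟨α, hα⟩ := h p hp k n ⊤ f (fun _ _ _ _ => AddSubgroup.mem_top _) hf
  exact (wonBy_of_gradedWonBy α ⊤ f hα).won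

/-- The `Γ″` key of a profile `(a₁, …, a_c)`: `(a₁, a₂ or ⊤, c, a₃, …)` — the round-3 value order
`Γ″ = lex (a₁, a₂, c, a₃, …, a_c)` (`c` = number of sections, placed AFTER the second profile entry).
[OURS · L1 W4.3, Sketch-L1-idea-1 v3 §6] -/
def gammaTwoKey (a : List ℚ) : ℚ × WithTop ℚ × ℕ × List ℚ :=
  (a.headD 0, ((a.drop 1).head?.map (↑) : Option (WithTop ℚ)).getD ⊤, a.length, a.drop 2)

/-- On fat points `Fₘ = Spec k[x₁..xₘ]/𝔪²` (profile `(2,…,2)`, `m` entries) the `Γ″` key ASCENDS with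
`m ≥ 2`, so the fat-pair escape (`weightedResolutionDatum_fatPairEscape` of the route's negative files) does
not bite: the centre of the pair sits on the LARGER fat point. [OURS · L1 W4.3, Sketch-L1-idea-1 v3 §6] -/
theorem gammaTwoKey_fatPoint_lt (m : ℕ) (hm : 2 ≤ m) :
    Prod.Lex (· < ·) (Prod.Lex (· < ·) (Prod.Lex (· < ·) (List.Lex (· < ·))))
      (gammaTwoKey (List.replicate m 2)) (gammaTwoKey (List.replicate (m + 1) 2)) := by
  obtain ⟨j, rfl⟩ : ∃ j, m = j + 2 := ⟨m - 2, by omega⟩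
  have h1 : gammaTwoKey (List.replicate (j + 2) 2) = (2, ((2 : ℚ) : WithTop ℚ), j + 2, List.replicate j 2) := by
    simp [gammaTwoKey, List.replicate_succ]
  have h2 : gammaTwoKey (List.replicate (j + 2 + 1) 2) =
      (2, ((2 : ℚ) : WithTop ℚ), j + 3, List.replicate (j + 1) 2) := by
    simp [gammaTwoKey, List.replicate_succ]
  rw [h1, h2]
  exact Prod.Lex.right _ (Prod.Lex.right _ (Prod.Lex.left _ _ (by omega)))

end GradedGame

end Summit.ResolutionOfSingularities.ResolutionOfSingularities.Theorems
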